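import Literature.AnabelianGeometry.SemiGraphs.PSCMultiVertexCriteria
import Literature.AnabelianGeometry.SemiGraphs.ProSigmaCuspInertiaMalnormalHolds
import Literature.AnabelianGeometry.SemiGraphs.ProSigmaCuspInertia
import Literature.AnabelianGeometry.SemiGraphs.ProSigmaCompletionModels
import Literature.GroupTheory.CombinatorialGroupTheory.PuncturedSurfaceGroupZeroFourBases
import HarnessLib

/-!
# A genuine TWO-VERTEX PSC datum: the two-tripod degeneration of the 4-pointed line — [CombGC] Prop. 1.2 (i)(ii) hold

Mochizuki, *A combinatorial version of the Grothendieck conjecture* [CombGC] §1, Def. 1.1 p. 6, Prop. 1.2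
p. 8 [cite: MochizukiCombGC2007, Prop 1.2 p.8].  The pointed stable curve of type `(0,4)` with two
irreducible components (each a tripod) glued at one node — cusps `c₁, c₂` on the first component,
`c₃, c₀` on the second — has PSC-fundamental group the pro-`Σ` completion `ι : Γ_{0,4} → Π` of
`Γ_{0,4} = ⟨c₀,…,c₃ ∣ c₀c₁c₂c₃⟩` (free on `c₁, c₂, c₃`), verticial subgroups
`Π_{v₁} = closure ι⟨c₁, c₂⟩ = closure ι⟨c₁, c₁c₂⟩`, `Π_{v₂} = closure ι⟨c₁c₂, c₃⟩ (∋ ι c₀)`, nodal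
subgroup `Π_e = closure ι⟨c₁c₂⟩` and cuspidal subgroups `Π_{c_j} = closure ι⟨c_j⟩` — all closures of
SUB-BASIS subgroups for the free bases `(c₁, c₁c₂, c₃)`, `(c₁c₂, c₂, c₃)`, `(c₁, c₁c₂, c₀⁻¹)` of
`PuncturedSurfaceGroupZeroFourBases.lean`.  For every `G : PSCDatum Π` of this TWO-TRIPOD SHAPE:

* `twoTripod_commensurablyTerminal` — **Prop. 1.2 (ii)** (verticial: free-factor malnormality
  `freeFactor_isCommensurablyTerminal`, Ribes–Zalesskii 9.1.12 for free pro-`Σ` groups,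
  `ProSigmaFreeFactor*.lean`; nodal: the rank-one case; cuspidal: [SemiAnbd] Ex. 2.10
  `cuspInertia_closure_isCommensurablyTerminal`; unramified clause vacuous, genus `0`);
* `twoTripod_openInterDeterminesComponent` — **Prop. 1.2 (i)** (verticial: `closure ι⟨c₁⟩ ≤ Π_{v₁}`
  meets every conjugate of `Π_{v₂}` trivially since `{0} ∩ {1,2} = ∅`,
  `freeFactor_inf_conj_eq_bot_of_disjoint`; edge-like: node/cusp pairs by the three bases, cusp/cusp
  pairs by [SemiAnbd] Ex. 2.10 `proSigmaCuspInertiaMalnormal_holds`);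
* `exists_twoVertexOrigin_holds` — an origin `Ω₂` all of whose data are of two-tripod shape satisfies
  the abc-iut FACT-LIST rows F-0438 (`CommensurableTerminalityHolds`) and F-0459
  (`OpenInterDeterminesComponentHolds`) and is INHABITED by the genuine datum over the profinite
  completion of `Γ_{0,4}` (`Σ` = all primes): the FIRST kernel instance of these rows at a pointed
  stable curve with MORE THAN ONE irreducible component (`i = 2`, `n = 1`, `r = 4`).

Instance forms at genuine anabelian data (consistency evidence for the typed schemata; not the printed
theorems for all pointed stable curves).  No side is taken on [IUTchIII] Cor. 3.12.
-/

noncomputable section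

namespace Literature.AnabelianGeometry.SemiGraphs

namespace PSCDatum

open scoped Pointwise
open Literature.GroupTheory.CombinatorialGroupTheory
open SemiGraphOfAnabelioids (IsProSigmaCompletion proSigmaCuspInertiaMalnormal_holds
  cuspInertia_closure_isCommensurablyTerminal infinite_cuspInertia_closure)
open SemiGraphOfAnabelioids.IsProSigmaCompletion (freeFactor_inf_conj_eq_bot_of_disjoint
  freeFactor_isCommensurablyTerminal infinite_freeFactor)

universe u

variable {P : Type u} [Group P] [TopologicalSpace P] [IsTopologicalGroup P] [CompactSpace P]
  [T2Space P] [TotallyDisconnectedSpace P] {Sigma : Set ℕ}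

/-! ### Sub-basis closures generated by one basis element -/

omit [CompactSpace P] [T2Space P] [TotallyDisconnectedSpace P] in
/-- `closure ι⟨b(k)⟩ = closure ι(zpowers (b k))`. [cite: MochizukiCombGC2007, Def 1.1(ii) p.6] -/
theorem freeFactor_singleton_eq {β Γ : Type*} [Group Γ] (ι : Γ →* P) (b : FreeGroupBasis β Γ)
    (k : β) : ((Subgroup.closure (b '' {k})).map ι).topologicalClosure =
      ((Subgroup.zpowers (b k)).map ι).topologicalClosure := by
  rw [Set.image_singleton, ← Subgroup.zpowers_eq_closure]

/-- Closures of the cyclic groups of two DISTINCT elements of one free basis meet every conjugate of each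
other trivially. [cite: MochizukiCombGC2007, Prop 1.2(i) p.8] -/
theorem zpowers_basis_inf_conj_eq_bot {β Γ : Type*} [Group Γ] {ι : Γ →* P}
    (hι : IsProSigmaCompletion Sigma ι) (b : FreeGroupBasis β Γ) {i j : β} (hij : i ≠ j) (g : P) :
    ((Subgroup.zpowers (b i)).map ι).topologicalClosure ⊓
      ConjAct.toConjAct g • ((Subgroup.zpowers (b j)).map ι).topologicalClosure = ⊥ := by
  rw [← freeFactor_singleton_eq ι b i, ← freeFactor_singleton_eq ι b j]
  exact freeFactor_inf_conj_eq_bot_of_disjoint b {i} {j} (Set.disjoint_singleton.mpr hij) hι g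

/-! ### The node group against the four cusp groups -/

/-- In the pro-`Σ` completion of `Γ_{0,4}`: `closure ι⟨c₁c₂⟩ ∩ g · closure ι⟨c_j⟩ · g⁻¹ = 1` for every
cusp `c_j` and every `g` (each pair `(c₁c₂, c_j^{±1})` is part of one of the three Nielsen bases).
[cite: MochizukiCombGC2007, Prop 1.2(i) p.8] -/
theorem node_inf_conj_cusp_eq_bot {ι : PuncturedSurfaceGroup 0 4 →* P}
    (hι : IsProSigmaCompletion Sigma ι) (j : Fin 4) (g : P) :
    ((Subgroup.zpowers (PuncturedSurfaceGroup.c 1 * PuncturedSurfaceGroup.c 2 :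
        PuncturedSurfaceGroup 0 4)).map ι).topologicalClosure ⊓
      ConjAct.toConjAct g •
        ((PuncturedSurfaceGroup.cuspInertia (g := 0) j).map ι).topologicalClosure = ⊥ := by
  obtain ⟨b, hb0, hb1, hb2⟩ := PuncturedSurfaceGroup.exists_freeGroupBasis_node
  obtain ⟨b₂, hb₂0, hb₂1, -⟩ := PuncturedSurfaceGroup.exists_freeGroupBasis_node_two
  obtain ⟨b₄, -, hb₄1, hb₄2⟩ := PuncturedSurfaceGroup.exists_freeGroupBasis_node_zero
  unfold PuncturedSurfaceGroup.cuspInertia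
  fin_cases j
  · -- `c₀`: basis `(c₁, c₁c₂, c₀⁻¹)`, members `1 ≠ 2`
    have h := zpowers_basis_inf_conj_eq_bot hι b₄ (show (1 : Fin 3) ≠ 2 by decide) g
    rwa [hb₄1, hb₄2, Subgroup.zpowers_inv] at h
  · -- `c₁`: basis `(c₁, c₁c₂, c₃)`, members `1 ≠ 0`
    have h := zpowers_basis_inf_conj_eq_bot hι b (show (1 : Fin 3) ≠ 0 by decide) g
    rwa [hb1, hb0] at h
  · -- `c₂`: basis `(c₁c₂, c₂, c₃)`, members `0 ≠ 1`
    have h := zpowers_basis_inf_conj_eq_bot hι b₂ (show (0 : Fin 3) ≠ 1 by decide) g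
    rwa [hb₂0, hb₂1] at h
  · -- `c₃`: basis `(c₁, c₁c₂, c₃)`, members `1 ≠ 2`
    have h := zpowers_basis_inf_conj_eq_bot hι b (show (1 : Fin 3) ≠ 2 by decide) g
    rwa [hb1, hb2] at h

/-! ### The rows at two-tripod shape -/

section TwoTripod

/-- **Prop. 1.2 (ii) at two-tripod shape**: `Π_{v₁} = closure ι⟨b₀, b₁⟩`, `Π_{v₂} = closure ι⟨b₁, b₂⟩`,
`Π_e = closure ι⟨b₁⟩` for a free basis `b` of `Γ_{0,4}`, cusp groups the closed cusp inertia groups, a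
component of genus `< 2`. [cite: MochizukiCombGC2007, Prop 1.2(ii) p.8] -/
theorem twoTripod_commensurablyTerminal (hne : Sigma.Nonempty) (hprime : ∀ p ∈ Sigma, p.Prime)
    (ι : PuncturedSurfaceGroup 0 4 →* P) (hι : IsProSigmaCompletion Sigma ι)
    (b : FreeGroupBasis (Fin 3) (PuncturedSurfaceGroup 0 4))
    (G : PSCDatum P) (v₁ v₂ : G.graph.V) (hV : ∀ v, v = v₁ ∨ v = v₂)
    (hV₁ : G.vertGp v₁ = ((Subgroup.closure (b '' {0, 1})).map ι).topologicalClosure)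
    (hV₂ : G.vertGp v₂ = ((Subgroup.closure (b '' {1, 2})).map ι).topologicalClosure)
    (hN : ∀ e, G.nodeGp e = ((Subgroup.closure (b '' {1})).map ι).topologicalClosure)
    (f : G.graph.C → Fin 4)
    (hC : ∀ c, G.cuspGp c =
      ((PuncturedSurfaceGroup.cuspInertia (g := 0) (f c)).map ι).topologicalClosure)
    (hg : G.genus v₁ < 2) :
    G.VerticialEdgeLikeCommensurablyTerminal ∧ G.UnrVerticialCommensurablyTerminal := by
  have hp : ∃ p ∈ Sigma, p.Prime := by
    obtain ⟨p, hp⟩ := hne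
    exact ⟨p, hp, hprime p hp⟩
  have h04 : PuncturedSurfaceGroup.IsHyperbolicType 0 4 := by
    unfold PuncturedSurfaceGroup.IsHyperbolicType; norm_num
  refine G.commensurablyTerminal_of (fun v => ?_) (fun e => ?_) (fun c => ?_) v₁ hg
  · rcases hV v with rfl | rfl
    · rw [hV₁]; exact freeFactor_isCommensurablyTerminal b _ ⟨0, by simp⟩ hι hp
    · rw [hV₂]; exact freeFactor_isCommensurablyTerminal b _ ⟨1, by simp⟩ hι hp
  · rw [hN]; exact freeFactor_isCommensurablyTerminal b _ ⟨1, rfl⟩ hι hp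
  · rw [hC]; exact cuspInertia_closure_isCommensurablyTerminal hne hprime h04 ι hι (f c)

/-- **Prop. 1.2 (i) at two-tripod shape** (`b 0 = c₁`, `b 1 = c₁c₂`, `b 2 = c₃`; two distinct vertices,
one node, the cusps injectively labelled by `Fin 4`). [cite: MochizukiCombGC2007, Prop 1.2(i) p.8] -/
theorem twoTripod_openInterDeterminesComponent (hne : Sigma.Nonempty) (hprime : ∀ p ∈ Sigma, p.Prime)
    (ι : PuncturedSurfaceGroup 0 4 →* P) (hι : IsProSigmaCompletion Sigma ι)
    (b : FreeGroupBasis (Fin 3) (PuncturedSurfaceGroup 0 4))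
    (hb : b 0 = PuncturedSurfaceGroup.c 1 ∧
      b 1 = PuncturedSurfaceGroup.c 1 * PuncturedSurfaceGroup.c 2 ∧ b 2 = PuncturedSurfaceGroup.c 3)
    (G : PSCDatum P) (v₁ v₂ : G.graph.V) (hv : v₁ ≠ v₂) (hV : ∀ v, v = v₁ ∨ v = v₂)
    (hV₁ : G.vertGp v₁ = ((Subgroup.closure (b '' {0, 1})).map ι).topologicalClosure)
    (hV₂ : G.vertGp v₂ = ((Subgroup.closure (b '' {1, 2})).map ι).topologicalClosure)
    (hN : ∀ e, G.nodeGp e = ((Subgroup.closure (b '' {1})).map ι).topologicalClosure)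
    (hNs : ∀ e e' : G.graph.N, e = e') (f : G.graph.C → Fin 4) (hf : Function.Injective f)
    (hC : ∀ c, G.cuspGp c =
      ((PuncturedSurfaceGroup.cuspInertia (g := 0) (f c)).map ι).topologicalClosure)
    (hg : G.genus v₁ < 2) :
    G.VerticialOpenInterDeterminesVertex ∧ G.EdgeLikeOpenInterDeterminesEdge ∧
      G.UnrVerticialOpenInterDeterminesVertex := by
  have hp : ∃ p ∈ Sigma, p.Prime := by
    obtain ⟨p, hp⟩ := hne
    exact ⟨p, hp, hprime p hp⟩
  have h04 : PuncturedSurfaceGroup.IsHyperbolicType 0 4 := by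
    unfold PuncturedSurfaceGroup.IsHyperbolicType; norm_num
  obtain ⟨hb0, hb1, hb2⟩ := hb
  refine G.openInterDeterminesComponent_of (fun v w hvw => ?_) (fun e => ?_)
    (fun e₁ e₂ hne12 g => ?_) v₁ hg
  · -- verticial: a cusp-inertia-type sub-factor of `Π_v` disjoint from the sub-basis of `Π_w`
    rcases hV v with rfl | rfl <;> rcases hV w with rfl | rfl
    · exact absurd rfl hvw
    · refine ⟨((Subgroup.closure (b '' {0})).map ι).topologicalClosure, ?_,
        Subgroup.isClosed_topologicalClosure _, infinite_freeFactor b _ ⟨0, rfl⟩ hι hp, fun g => ?_⟩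
      · rw [hV₁]
        exact Subgroup.topologicalClosure_mono (Subgroup.map_mono (Subgroup.closure_mono
          (Set.image_mono (Set.singleton_subset_iff.mpr (by simp)))))
      · rw [hV₂]
        exact freeFactor_inf_conj_eq_bot_of_disjoint b {0} {1, 2}
          (Set.disjoint_singleton_left.mpr (by simp)) hι g
    · refine ⟨((Subgroup.closure (b '' {2})).map ι).topologicalClosure, ?_,
        Subgroup.isClosed_topologicalClosure _, infinite_freeFactor b _ ⟨2, rfl⟩ hι hp, fun g => ?_⟩
      · rw [hV₂]
        exact Subgroup.topologicalClosure_mono (Subgroup.map_mono (Subgroup.closure_mono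
          (Set.image_mono (Set.singleton_subset_iff.mpr (by simp)))))
      · rw [hV₁]
        exact freeFactor_inf_conj_eq_bot_of_disjoint b {2} {0, 1}
          (Set.disjoint_singleton_left.mpr (by simp)) hι g
    · exact absurd rfl hvw
  · -- edge groups are infinite
    rcases e with e | c
    · change Infinite (G.nodeGp e)
      rw [hN]; exact infinite_freeFactor b _ ⟨1, rfl⟩ hι hp
    · change Infinite (G.cuspGp c)
      rw [hC]; exact infinite_cuspInertia_closure hne hprime h04 ι hι (f c)
  · -- distinct edges: everywhere-disjoint conjugates
    have hnode : ∀ (e : G.graph.N) (c : G.graph.C) (g : P),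
        G.nodeGp e ⊓ ConjAct.toConjAct g • G.cuspGp c = ⊥ := by
      intro e c g
      rw [hN, hC, freeFactor_singleton_eq, hb1]
      exact node_inf_conj_cusp_eq_bot hι (f c) g
    rcases e₁ with e | c <;> rcases e₂ with e' | c'
    · exact absurd (congrArg Sum.inl (hNs e e')) hne12
    · exact hnode e c' g
    · exact inf_conj_eq_bot_symm (hnode e' c) g
    · have hcc : f c ≠ f c' := fun h => hne12 (by rw [hf h])
      change G.cuspGp c ⊓ ConjAct.toConjAct g • G.cuspGp c' = ⊥
      rw [hC, hC]
      exact (proSigmaCuspInertiaMalnormal_holds Sigma hne hprime 0 4 h04 P ι hι (f c) (f c')).2 g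
        (Or.inl hcc)

end TwoTripod

/-! ### The origin of two-tripod-shaped data: rows F-0438 / F-0459, inhabited by the genuine datum -/

section Origin

variable (Ω : PSCOrigin.{u})

/-- **F-0438 ∧ F-0459 ([CombGC] Prop. 1.2 (ii) and (i))** at every origin whose data are of two-tripod
shape (profinite carriers). [cite: MochizukiCombGC2007, Prop 1.2 p.8] -/
theorem prop12Holds_of_twoTripod
    (hΩ : ∀ ⦃Q : Type u⦄ [Group Q] [TopologicalSpace Q] [IsTopologicalGroup Q] (G : PSCDatum Q),
      Ω.IsOfPSCType G → CompactSpace Q ∧ T2Space Q ∧ TotallyDisconnectedSpace Q ∧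
        ∃ (S : Set ℕ) (ι : PuncturedSurfaceGroup 0 4 →* Q)
          (b : FreeGroupBasis (Fin 3) (PuncturedSurfaceGroup 0 4)) (v₁ v₂ : G.graph.V)
          (f : G.graph.C → Fin 4),
          S.Nonempty ∧ (∀ p ∈ S, p.Prime) ∧ IsProSigmaCompletion S ι ∧
          (b 0 = PuncturedSurfaceGroup.c 1 ∧ b 1 = PuncturedSurfaceGroup.c 1 * PuncturedSurfaceGroup.c 2 ∧
            b 2 = PuncturedSurfaceGroup.c 3) ∧
          v₁ ≠ v₂ ∧ (∀ v, v = v₁ ∨ v = v₂) ∧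
          G.vertGp v₁ = ((Subgroup.closure (b '' {0, 1})).map ι).topologicalClosure ∧
          G.vertGp v₂ = ((Subgroup.closure (b '' {1, 2})).map ι).topologicalClosure ∧
          (∀ e, G.nodeGp e = ((Subgroup.closure (b '' {1})).map ι).topologicalClosure) ∧
          (∀ e e' : G.graph.N, e = e') ∧ Function.Injective f ∧
          (∀ c, G.cuspGp c =
            ((PuncturedSurfaceGroup.cuspInertia (g := 0) (f c)).map ι).topologicalClosure) ∧
          G.genus v₁ < 2) :
    CommensurableTerminalityHolds Ω ∧ OpenInterDeterminesComponentHolds Ω := by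
  constructor
  · intro Q _ _ _ G hG
    obtain ⟨_, _, _, S, ι, b, v₁, v₂, f, hne, hprime, hι, hb, hv, hV, hV₁, hV₂, hN, hNs, hf, hC, hg⟩ :=
      hΩ G hG
    exact twoTripod_commensurablyTerminal hne hprime ι hι b G v₁ v₂ hV hV₁ hV₂ hN f hC hg
  · intro Q _ _ _ G hG
    obtain ⟨_, _, _, S, ι, b, v₁, v₂, f, hne, hprime, hι, hb, hv, hV, hV₁, hV₂, hN, hNs, hf, hC, hg⟩ :=
      hΩ G hG
    exact twoTripod_openInterDeterminesComponent hne hprime ι hι b hb G v₁ v₂ hv hV hV₁ hV₂ hN hNs f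
      hf hC hg

/-- **[CombGC] Prop. 1.2 (i)(ii) (F-0459, F-0438) HOLD at an origin inhabited by a GENUINE TWO-VERTEX
datum.**  The origin `Ω₂` of two-tripod-shaped data contains the datum of the stable curve "two tripods
glued at a node" (type `(0,4)`, `i = 2` components, `n = 1` node, `r = 4` cusps, genera `0`) over
`Π = Γ̂_{0,4}` (Mathlib's profinite completion, `Σ` = all primes, `ι = η` a pro-`Σ` completion by
`isProSigmaCompletion_toCompletion`): `Π_{v₁} = closure η⟨c₁, c₁c₂⟩`, `Π_{v₂} = closure η⟨c₁c₂, c₃⟩`,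
`Π_e = closure η⟨c₁c₂⟩`, `Π_{c_j} = closure η⟨c_j⟩`.  Genuine anabelian content: free-factor malnormality
in the pro-`Σ` completion (Ribes–Zalesskii Thm. 9.1.12, proved in the tree without Kurosh) and the cusp
inertia theorems of [SemiAnbd] Ex. 2.10.  First multi-vertex instance of these rows; consistency
evidence for the typed schemata, not the printed theorems for all pointed stable curves.
[cite: MochizukiCombGC2007, Prop 1.2 p.8] -/
theorem exists_twoVertexOrigin_holds :
    ∃ Ω : PSCOrigin.{0},
      (∃ G : PSCDatum (Literature.IUT.HodgeTheaters.profiniteCompletion (PuncturedSurfaceGroup 0 4)),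
        Ω.IsOfPSCType G ∧ G.Sigma = {p : ℕ | p.Prime} ∧ G.graph.i = 2 ∧ G.graph.n = 1 ∧ G.graph.r = 4 ∧
          (∀ v, G.genus v = 0) ∧
          (∀ e, G.nodeGp e = ((Subgroup.zpowers
            (PuncturedSurfaceGroup.c 1 * PuncturedSurfaceGroup.c 2 : PuncturedSurfaceGroup 0 4)).map
            (Literature.IUT.HodgeTheaters.toCompletion (PuncturedSurfaceGroup 0 4))).topologicalClosure) ∧
          ∀ c, ∃ j : Fin 4, G.cuspGp c = ((PuncturedSurfaceGroup.cuspInertia (g := 0) j).map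
            (Literature.IUT.HodgeTheaters.toCompletion (PuncturedSurfaceGroup 0 4))).topologicalClosure) ∧
      CommensurableTerminalityHolds Ω ∧ OpenInterDeterminesComponentHolds Ω := by
  let Ω : PSCOrigin.{0} :=
    ⟨fun {Q} _ _ G => ∃ (_ : IsTopologicalGroup Q), CompactSpace Q ∧ T2Space Q ∧
      TotallyDisconnectedSpace Q ∧
        ∃ (S : Set ℕ) (ι : PuncturedSurfaceGroup 0 4 →* Q)
          (b : FreeGroupBasis (Fin 3) (PuncturedSurfaceGroup 0 4)) (v₁ v₂ : G.graph.V)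
          (f : G.graph.C → Fin 4),
          S.Nonempty ∧ (∀ p ∈ S, p.Prime) ∧ IsProSigmaCompletion S ι ∧
          (b 0 = PuncturedSurfaceGroup.c 1 ∧ b 1 = PuncturedSurfaceGroup.c 1 * PuncturedSurfaceGroup.c 2 ∧
            b 2 = PuncturedSurfaceGroup.c 3) ∧
          v₁ ≠ v₂ ∧ (∀ v, v = v₁ ∨ v = v₂) ∧
          G.vertGp v₁ = ((Subgroup.closure (b '' {0, 1})).map ι).topologicalClosure ∧
          G.vertGp v₂ = ((Subgroup.closure (b '' {1, 2})).map ι).topologicalClosure ∧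
          (∀ e, G.nodeGp e = ((Subgroup.closure (b '' {1})).map ι).topologicalClosure) ∧
          (∀ e e' : G.graph.N, e = e') ∧ Function.Injective f ∧
          (∀ c, G.cuspGp c =
            ((PuncturedSurfaceGroup.cuspInertia (g := 0) (f c)).map ι).topologicalClosure) ∧
          G.genus v₁ < 2⟩
  -- the genuine datum
  let Γ := PuncturedSurfaceGroup 0 4
  let η := Literature.IUT.HodgeTheaters.toCompletion Γ
  have hη : IsProSigmaCompletion {p : ℕ | p.Prime} η :=
    SemiGraphOfAnabelioids.IsProSigmaCompletion.isProSigmaCompletion_toCompletion Γ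
  obtain ⟨b, hb0, hb1, hb2⟩ := PuncturedSurfaceGroup.exists_freeGroupBasis_node
  -- membership of the cusp generators in the two verticial free factors
  have hmem01 : ∀ x ∈ Subgroup.closure (b '' {0, 1}),
      ((Subgroup.zpowers x).map η).topologicalClosure ≤
        ((Subgroup.closure (b '' {0, 1})).map η).topologicalClosure := fun x hx =>
    Subgroup.topologicalClosure_mono (Subgroup.map_mono ((Subgroup.zpowers_le (g := x)).mpr hx))
  have hmem12 : ∀ x ∈ Subgroup.closure (b '' {1, 2}),
      ((Subgroup.zpowers x).map η).topologicalClosure ≤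
        ((Subgroup.closure (b '' {1, 2})).map η).topologicalClosure := fun x hx =>
    Subgroup.topologicalClosure_mono (Subgroup.map_mono ((Subgroup.zpowers_le (g := x)).mpr hx))
  have hgen : ∀ (S : Set (Fin 3)) (k : Fin 3), k ∈ S → b k ∈ Subgroup.closure (b '' S) :=
    fun S k hk => Subgroup.subset_closure ⟨k, hk, rfl⟩
  have hc1 : (PuncturedSurfaceGroup.c 1 : Γ) ∈ Subgroup.closure (b '' {0, 1}) := by
    rw [← hb0]; exact hgen _ 0 (by simp)
  have hc2 : (PuncturedSurfaceGroup.c 2 : Γ) ∈ Subgroup.closure (b '' {0, 1}) := by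
    have : (PuncturedSurfaceGroup.c 2 : Γ) = (b 0)⁻¹ * b 1 := by
      rw [hb0, hb1, inv_mul_cancel_left]
    rw [this]
    exact Subgroup.mul_mem _ (Subgroup.inv_mem _ (hgen _ 0 (by simp))) (hgen _ 1 (by simp))
  have hc3 : (PuncturedSurfaceGroup.c 3 : Γ) ∈ Subgroup.closure (b '' {1, 2}) := by
    rw [← hb2]; exact hgen _ 2 (by simp)
  have hc0 : (PuncturedSurfaceGroup.c 0 : Γ) ∈ Subgroup.closure (b '' {1, 2}) := by
    have : (PuncturedSurfaceGroup.c 0 : Γ) = (b 1 * b 2)⁻¹ := by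
      rw [hb1, hb2, PuncturedSurfaceGroup.c_zero_eq_inv]
    rw [this]
    exact Subgroup.inv_mem _ (Subgroup.mul_mem _ (hgen _ 1 (by simp)) (hgen _ 2 (by simp)))
  have hnode01 : (b 1 : Γ) ∈ Subgroup.closure (b '' {0, 1}) := hgen _ 1 (by simp)
  have hnode12 : (b 1 : Γ) ∈ Subgroup.closure (b '' {1, 2}) := hgen _ 1 (by simp)
  let T : PSCDatum (Literature.IUT.HodgeTheaters.profiniteCompletion Γ) :=
    { Sigma := {p | p.Prime}
      sigma_prime := fun _ hp => hp
      sigma_nonempty := ⟨2, Nat.prime_two⟩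
      graph := { V := Fin 2, N := Unit, C := Fin 4, nodeEnds := fun _ => s(0, 1),
                 cuspEnd := ![1, 0, 0, 1] }
      vertGp := ![((Subgroup.closure (b '' {0, 1})).map η).topologicalClosure,
        ((Subgroup.closure (b '' {1, 2})).map η).topologicalClosure]
      nodeGp := fun _ => ((Subgroup.closure (b '' {1})).map η).topologicalClosure
      cuspGp := fun j => ((PuncturedSurfaceGroup.cuspInertia (g := 0) j).map η).topologicalClosure
      genus := fun _ => 0
      isClosed_vertGp := fun v => by
        fin_cases v <;> exact Subgroup.isClosed_topologicalClosure _
      isClosed_nodeGp := fun _ => Subgroup.isClosed_topologicalClosure _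
      isClosed_cuspGp := fun _ => Subgroup.isClosed_topologicalClosure _
      nodeGp_le := fun _ => ⟨0, 1, rfl,
        ⟨1, by rw [one_smul, freeFactor_singleton_eq]; exact hmem01 _ hnode01⟩,
        ⟨1, by rw [one_smul, freeFactor_singleton_eq]; exact hmem12 _ hnode12⟩⟩
      cuspGp_le := fun j => ⟨1, by
        rw [one_smul]
        fin_cases j
        · exact hmem12 _ hc0
        · exact hmem01 _ hc1
        · exact hmem01 _ hc2
        · exact hmem12 _ hc3⟩
      proSigma := ⟨fun _ _ _ hp _ => hp⟩ }
  have hT : Ω.IsOfPSCType T :=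
    ⟨inferInstance, inferInstance, inferInstance, inferInstance, {p | p.Prime}, η, b, 0, 1, id,
      ⟨2, Nat.prime_two⟩, fun _ hp => hp, hη, ⟨hb0, hb1, hb2⟩,
      by change (0 : Fin 2) ≠ 1; decide,
      fun v => by fin_cases v <;> simp, rfl, rfl, fun _ => rfl, fun _ _ => rfl,
      Function.injective_id, fun _ => rfl, by change (0 : ℕ) < 2; norm_num⟩
  refine ⟨Ω, ⟨T, hT, rfl, rfl, rfl, rfl, fun _ => rfl, fun _ => ?_, fun c => ⟨c, rfl⟩⟩, ?_⟩
  · change ((Subgroup.closure (b '' {1})).map η).topologicalClosure = _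
    rw [freeFactor_singleton_eq, hb1]
  · exact prop12Holds_of_twoTripod Ω fun Q _ _ _ G hG => by
      obtain ⟨_, h1, h2, h3, hrest⟩ := hG
      exact ⟨h1, h2, h3, hrest⟩

end Origin

end PSCDatum

end Literature.AnabelianGeometry.SemiGraphs

end
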